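import Summits.BirchSwinnertonDyer.Rank1Residual.X2.CongruentPartnerTrace
import Summits.BirchSwinnertonDyer.Rank1Residual.X2.IsogenyQuotientLine
import Summits.BirchSwinnertonDyer.Rank1Residual.X2.RankOneNonsplitTransfer
import Literature.NumberTheory.EllipticCurves.Rank1Residual.GVParityLineTypeProofs
import Literature.NumberTheory.EllipticCurves.TateCurve.NumberFieldUniformizationTwisted
import Literature.NumberTheory.GaloisRepresentations.ModNCyclotomicCharacter
import Literature.NumberTheory.GaloisRepresentations.ArtinDirichletCoefficients
import HarnessLib

/-!
# Crux 3 `MazurMCOnCellB` (stmt-BirchSwinnertonDyer-19033), line `twistback` v4 — brick (F3):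
# at an odd multiplicative prime `p`, the quotient character `ψ` of a RAMIFIED rational line takes
# the value `ψ(p) = a_p(E) ∈ {±1}` — `+1` at a split, `−1` at a non-split prime

Width seat bsd-line-x2-p1-w7 (g0), LEAD g10's WORKER-FIT brick (F3) of 2026-08-28T16:18:19Z.
HONEST FRAMING (cell `bsd-eis`, run/shared/lean/pub/bsd-eis/): TOOL THEOREMS ONLY (no `def`, no
named fact, no `sorry`); every input is a tree THEOREM (the two Tate uniformisation facts are
DISCHARGED in the tree: `TateCurve.Silverman1994_thmV53_tateUniformisation_holds`,
`TateCurve.Silverman1994_thmV53_corV54_tateUniformisation_holds`); nothing is booked; no main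
conjecture / BSD is proved for any curve; no summit statement is proved; 0 cells / labels move.

WHY. The KL-flat door of the line (`…TwistbackKLFlatPartner` §1–§3, p645525; `…KLFlatPartnerUnits`
§1–§3, p645771) carries, per pair, the hypothesis `hψp : ψ (p : ZMod d) ≠ 1` for the quotient
character `ψ` (primitive mod `d`, `p ∤ d`, `hψ0` shape `σ • Q ≡ ψ(χ_d σ) • Q (mod Φ₀)`) of the
ramified-even line `Φ₀` on the carrier `V′` — "no trivial zero of `L_p(ωψ⁻¹, s)` at `s = 0`"
(Washington Thm. 5.11's factor `1 − χω⁻¹(p)`); the same `ψ(p) ≠ 1` is hypothesis (1) of Kriz–Li's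
Thm. 1.20 as typed (`KrizLi2019.EisensteinHeegnerLog`). Greenberg–Vatsal (Invent. Math. 142 (2000),
§2 pp. 14–15, §3 p. 42): at `p ‖ N` the `G_{ℚ_p}`-module `E[p^∞]` is `0 → C → E[p^∞] → D → 0`
with `D` unramified, `Frob_p` acting on `D` TRIVIALLY at a split prime and by the unramified
QUADRATIC character at a non-split prime; the ramified line is `C[p]`, so its quotient character
is that of `D[p]`: **`ψ(p) = a_p(E)`**. This file proves it in the tree's vocabulary:

* §1 algebra in `E[p]`: `dvd_of_forall_zsmul_mem`, `natCast_eq_intCast_of_smul_sub_mem` (two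
  scalars by which one `σ` acts on `E[p]/Φ`, `#Φ = p`, agree in `𝔽_p`);
* §2 `modNCyclotomicCharacter_absGaloisRestrict_frob`: for a local arithmetic Frobenius `τ ∈ Γ_{ℚ_v}`
  (`v ∣ p`) and `p ∤ d`, `χ_d(res τ) = p` (`res τ` is an arithmetic Frobenius at `ι⁻¹𝔐 ∩ \bar ℤ`,
  `WeierstrassCurve.isArithFrobAt_resGalOfEmb`; `χ_d(Frob) = N v`,
  `modNCyclotomicCharacter_eq_residueCard_of_isArithFrobAt`);
* §3 **`psi_natCast_eq_neg_one_of_not_split`** — NON-split odd `p`, `Φ₀` a RAMIFIED rational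
  line, `ψ` its quotient character mod `d ∌ p`: `ψ(p) = −1`; `psi_natCast_ne_one_of_not_split`.
  Mechanism: the X2 cell's `CongruentPartnerTrace.exists_line_of_not_split` (a line `X₀` of order
  `p` with `res τ ≡ −1` and the local inertia `≡ 1` on `E[p]/X₀`, from the twisted Tate
  uniformisation and `GreenbergVatsalTateFrobeniusSign`: Frobenius flips `√γ`), Neukirch II (9.6)
  (`inertia_adicCompletionPrime_eq_map_absInertia`), and "a ramified rational line is Serre's
  line" (`eq_of_not_lineUnramifiedAt`): `Φ₀ = X₀`;
* §4 **`psi_natCast_eq_one_of_split`** — SPLIT `p` (any `p`): `ψ(p) = 1`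
  (`TateLineDecomposition.fix_or_quot_of_split`; `D_v` cannot fix the ramified `Φ₀` since
  `I_{𝔓₀} ≤ D_v` moves it, `exists_inertia_smul_ne_of_not_lineUnramifiedAt`);
  `psi_natCast_eq_ite` (`ψ(p) = [split] − [non-split]`),
  `hasSplitMultiplicativeReductionAtPrime_iff_psi_natCast_eq_one`;
* (sequel `…LinePhiAtMultiplicativePrime`: the UNRAMIFIED line's own character `φ` has `φ(p) = a_p(E)`);
* §5 at the consumers' binders: `psi_natCast_eq_neg_one_of_isIsogenous_of_not_split` (carrier
  `ℚ`-isogenous to a non-split curve) and **`psi_natCast_ne_one_of_twist_carrier`** — `W` non-split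
  X2 at `p`, `K` with `p` split, `Wd` a minimal model of `E^{(d_K)}`, `V′` isogenous to `Wd`, `Φ₀`
  ramified on `V′`: `ψ(p) = −1 ≠ 1`, i.e. the `hψp` binder of p645771 §2/§3 DISCHARGED.

References: [GreenbergVatsal2000] §2 pp. 14–15, p. 28, §3 p. 42; [SilvermanATAEC1994] Ch. V
Lemma 5.2 (c), Thm. 5.3, Cor. 5.4, Ex. 5.11; [SilvermanAEC2009] VII.5 Prop. 5.1 (b), §C.16;
[NeukirchANT1999] Ch. I §10 (10.3), Ch. II §9 Prop. (9.6); [Washington1997] Thm. 5.11.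
-/

set_option autoImplicit false
set_option linter.dupNamespace false

noncomputable section

open scoped Classical Pointwise

open NumberField IsDedekindDomain Field WeierstrassCurve
  Literature.NumberTheory.EllipticCurves Literature.NumberTheory.GaloisRepresentations
  Literature.NumberTheory.EllipticCurves.GreenbergSelmer
  Literature.NumberTheory.EllipticCurves.Rank1Residual
  Summit.BirchSwinnertonDyer.Rank1Residual.X2.GreenbergVatsalTateDatum
  Summit.BirchSwinnertonDyer.Rank1Residual.X2.GreenbergVatsalTateDatumSign
  Summit.BirchSwinnertonDyer.Rank1Residual.X2.GreenbergVatsalTateFrobeniusSign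
  Summit.BirchSwinnertonDyer.Rank1Residual.X2

namespace Summit.BirchSwinnertonDyer.BirchSwinnertonDyer.Theorems.EisensteinPrimesLinePsiAtMultiplicativePrime

variable {W : WeierstrassCurve ℚ} [W.IsElliptic] {p : ℕ} [hp : Fact p.Prime]

/-! ## §1. Algebra in `E[p]`: a scalar congruence read off a line -/

/-- If `k • Q` lies in a subgroup `Φ ≤ E[p]` of order `p` for EVERY `Q ∈ E[p]`, then `p ∣ k`
(otherwise `k` is invertible on the `p`-torsion and `Φ = E[p]`, of order `p²`). [folklore] -/
theorem dvd_of_forall_zsmul_mem {Φ : AddSubgroup (geomTorsion W (p : ℤ))} (hΦ : Nat.card Φ = p)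
    {k : ℤ} (hk : ∀ Q : geomTorsion W (p : ℤ), k • Q ∈ Φ) : (p : ℤ) ∣ k := by
  by_contra hndvd
  have hpp := hp.out
  obtain ⟨Q, hQ⟩ := CongruentPartnerTrace.exists_not_mem_of_card_eq (W' := W) hΦ
  have hpi : Prime (p : ℤ) := Nat.prime_iff_prime_int.mp hpp
  obtain ⟨a, b, hab⟩ := (hpi.irreducible.coprime_iff_not_dvd).mpr hndvd
  have hpQ : (p : ℤ) • Q = 0 := by
    rw [natCast_zsmul]
    exact AddSubgroup.torsionBy.nsmul Q
  apply hQ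
  have hQeq : Q = b • (k • Q) := by
    conv_lhs => rw [← one_zsmul Q, ← hab]
    rw [add_zsmul, mul_zsmul, mul_zsmul, hpQ, zsmul_zero, zero_add]
  rw [hQeq]
  exact Φ.zsmul_mem (hk Q) b

/-- **Two scalars congruent modulo a line agree mod `p`.** If `σ ∈ Γ_ℚ` acts on `E[p]/Φ`
(`#Φ = p`) both as the integer `s` and as the natural number `n`, then `n = s` in `𝔽_p`. [folklore] -/
theorem natCast_eq_intCast_of_smul_sub_mem {Φ : AddSubgroup (geomTorsion W (p : ℤ))}
    (hΦ : Nat.card Φ = p) {σ : absoluteGaloisGroup ℚ} {s : ℤ} {n : ℕ}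
    (hs : ∀ Q : geomTorsion W (p : ℤ), σ • Q - s • Q ∈ Φ)
    (hn : ∀ Q : geomTorsion W (p : ℤ), σ • Q - n • Q ∈ Φ) :
    (n : ZMod p) = (s : ZMod p) := by
  have hk : ∀ Q : geomTorsion W (p : ℤ), (s - (n : ℤ)) • Q ∈ Φ := fun Q ↦ by
    have h := Φ.sub_mem (hn Q) (hs Q)
    have e : σ • Q - n • Q - (σ • Q - s • Q) = (s - (n : ℤ)) • Q := by
      rw [sub_zsmul, natCast_zsmul]; abel
    rwa [e] at h
  have hdvd := dvd_of_forall_zsmul_mem hΦ hk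
  have h0 : ((s - (n : ℤ) : ℤ) : ZMod p) = 0 := (ZMod.intCast_zmod_eq_zero_iff_dvd _ p).mpr hdvd
  rw [Int.cast_sub, Int.cast_natCast, sub_eq_zero] at h0
  exact h0.symm


/-! ## §2. Globalisation of a local arithmetic Frobenius at `v ∣ p`: the mod `d` cyclotomic
character takes the value `p` -/

omit hp in
/-- For the place `v` of `ℚ` above `p`, a prime `𝔐` of the local absolute integers above `𝓂_v`,
a local arithmetic Frobenius `τ ∈ Γ_{ℚ_v}` at `𝔐` and `d` prime to `p`: the restriction
`res τ ∈ Γ_ℚ` has `χ_d(res τ) = p` (it is an arithmetic Frobenius at the prime `ι⁻¹𝔐 ∩ \bar ℤ`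
above `p`, Neukirch II (9.6), and `χ_d(Frob_p) = p`, Neukirch I (10.3)).
[cite: NeukirchANT1999, Ch. I §10 (10.3) and Ch. II §9 Prop. (9.6)] -/
theorem modNCyclotomicCharacter_absGaloisRestrict_frob {v : HeightOneSpectrum (𝓞 ℚ)}
    (hv : (Rat.HeightOneSpectrum.primesEquiv v : ℕ) = p)
    {𝔐 : Ideal v.localAbsIntegers} (h𝔐 : 𝔐 ∈ v.localPrimesAbove)
    {τ : absoluteGaloisGroup (v.adicCompletion ℚ)}
    (hτ : IsArithFrobAt (v.adicCompletionIntegers ℚ) τ 𝔐) (d : ℕ) [NeZero d] (hpd : ¬ p ∣ d) :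
    ((modNCyclotomicCharacter ℚ d (absGaloisRestrict ℚ (v.adicCompletion ℚ) τ) : (ZMod d)ˣ) :
      ZMod d) = (p : ZMod d) := by
  set ι : AlgebraicClosure ℚ →ₐ[ℚ] AlgebraicClosure (v.adicCompletion ℚ) :=
    closureEmb (K := ℚ) (v.adicCompletion ℚ) with hι
  have hres : resGalOfEmb ι τ = absGaloisRestrict ℚ (v.adicCompletion ℚ) τ := rfl
  have h𝔓₁ : v.primeBelow ι 𝔐 ∈ v.primesAbove :=
    IsDedekindDomain.HeightOneSpectrum.primeBelow_mem_primesAbove (ι := ι) h𝔐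
  have hσ₁ : IsArithFrobAt (𝓞 ℚ) (absGaloisRestrict ℚ (v.adicCompletion ℚ) τ) (v.primeBelow ι 𝔐) := by
    have h := WeierstrassCurve.isArithFrobAt_resGalOfEmb h𝔐 ι hτ
    rwa [hres] at h
  have hN : (d : absIntegers (𝓞 ℚ) ℚ) ∉ v.primeBelow ι 𝔐 :=
    Rat.natCast_not_mem_of_mem_primesAbove_of_not_dvd h𝔓₁ (by rw [hv]; exact hpd)
  rw [modNCyclotomicCharacter_eq_residueCard_of_isArithFrobAt h𝔓₁ hN hσ₁,
    Rat.residueCard_eq_natGenerator' v]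
  exact congrArg (Nat.cast : ℕ → ZMod d) hv

/-! ## §3. NON-SPLIT: `ψ(p) = −1` -/

/-- **`ψ(p) = −1` at an odd prime of NON-SPLIT multiplicative reduction.** Let `E = W/ℚ` be
globally minimal with non-split multiplicative reduction at the odd prime `p`, `Φ₀ ≤ E[p]` a rational
line RAMIFIED at `p`, and `ψ` a Dirichlet character mod `d`, `p ∤ d`, with values in `𝔽_p`
presenting the action of `Γ_ℚ` on the quotient `E[p]/Φ₀` through the mod `d` cyclotomic character
(`σ • Q ≡ ψ(χ_d σ) • Q (mod Φ₀)`, the `hψ0` shape of Greenberg–Vatsal's §3). Then `ψ(p) = −1`.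
Proof: `Φ₀` is the Tate line `C[p]` (a ramified rational line is Serre's line,
`eq_of_not_lineUnramifiedAt`, against the line of `CongruentPartnerTrace.exists_line_of_not_split`
whose quotient is inertially trivial); a local arithmetic Frobenius `τ` flips `√γ`, so acts as `−1`
on `E[p]/C[p]` (twisted Tate uniformisation, Silverman *ATAEC* V.5.2 (c)/5.3/5.4, DISCHARGED in the
tree: `TateCurve.Silverman1994_thmV53_corV54_tateUniformisation_holds`); and `χ_d(res τ) = p`
(§2). So `ψ(p) ≡ −1`. This is Greenberg–Vatsal's "`ψ` unramified at `p` … the unramified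
quadratic character in the non-split case" read at Frobenius. [cite: GreenbergVatsal2000, §2 pp. 14–15 and §3 p. 42]
[cite: SilvermanATAEC1994, Ch. V Lemma 5.2 (c), Thm. 5.3 (a),(b), Cor. 5.4 (held copy PDF pp. 406–410)]
[cite: NeukirchANT1999, Ch. I §10 (10.3) and Ch. II §9 Prop. (9.6)] -/
theorem psi_natCast_eq_neg_one_of_not_split [W.IsGloballyMinimal] (hp2 : p ≠ 2)
    (hmult : W.HasMultiplicativeReductionAtPrime p)
    (hns : ¬ W.HasSplitMultiplicativeReductionAtPrime p)
    {Φ₀ : AddSubgroup (geomTorsion W (p : ℤ))} (hΦ : IsRationalLine W p Φ₀)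
    (hram : ¬ LineUnramifiedAt W p Φ₀)
    {d : ℕ} [NeZero d] (ψ : DirichletCharacter (ZMod p) d) (hpd : ¬ p ∣ d)
    (hψ0 : ∀ (σ : absoluteGaloisGroup ℚ) (Q : geomTorsion W (p : ℤ)),
      σ • Q - (ψ ((modNCyclotomicCharacter ℚ d σ : (ZMod d)ˣ) : ZMod d)).val • Q ∈ Φ₀) :
    ψ (p : ZMod d) = -1 := by
  have hpp := hp.out
  -- the place above `p`, a local prime, a local Frobenius
  set v : HeightOneSpectrum (𝓞 ℚ) := (Rat.HeightOneSpectrum.primesEquiv).symm ⟨p, hpp⟩ with hvdef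
  have hv : (Rat.HeightOneSpectrum.primesEquiv v : ℕ) = p := by
    rw [hvdef, Equiv.apply_symm_apply]
  have hpv : ((p : ℕ) : 𝓞 ℚ) ∈ v.asIdeal := natCast_mem_asIdeal_of_primesEquiv_eq hv
  obtain ⟨𝔐, h𝔐⟩ := v.localPrimesAbove_nonempty
  obtain ⟨τ, hτ⟩ := IsDedekindDomain.HeightOneSpectrum.exists_isArithFrobAt_localAbsIntegers v h𝔐
  -- the Tate line with its Frobenius (`−1`) and inertia (trivial) on the quotient
  obtain ⟨X, hXcard, hflip, hinert⟩ := CongruentPartnerTrace.exists_line_of_not_split W p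
    TateCurve.Silverman1994_thmV53_corV54_tateUniformisation_holds hp2 hmult hns hpv h𝔐 hτ
  -- the local inertia statement, read on the inertia group of `𝔓₀ = adicCompletionPrime ℚ v`
  -- (Neukirch II (9.6): `I_{𝔓₀} = res(I(ℚ̄_v/ℚ_v))`)
  have hI₀ : ∀ j ∈ (adicCompletionPrime ℚ v).inertia (absoluteGaloisGroup ℚ),
      ∀ P : geomTorsion W (p : ℤ), j • P - P ∈ X := by
    intro j hj P
    rw [inertia_adicCompletionPrime_eq_map_absInertia] at hj
    obtain ⟨σ, hσI, rfl⟩ := hj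
    exact hinert σ hσI P
  -- the ramified rational line IS the Tate line
  have hΦX : Φ₀ = X :=
    eq_of_not_lineUnramifiedAt hΦ hram hpv (adicCompletionPrime_mem_primesAbove ℚ v) hXcard hI₀
  -- Frobenius acts as `−1` and as `ψ(p)` on `E[p]/Φ₀`
  set σ₁ : absoluteGaloisGroup ℚ := absGaloisRestrict ℚ (v.adicCompletion ℚ) τ with hσ₁def
  have hχ : ((modNCyclotomicCharacter ℚ d σ₁ : (ZMod d)ˣ) : ZMod d) = (p : ZMod d) :=
    modNCyclotomicCharacter_absGaloisRestrict_frob hv h𝔐 hτ d hpd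
  have hs : ∀ Q : geomTorsion W (p : ℤ), σ₁ • Q - (-1 : ℤ) • Q ∈ Φ₀ := fun Q ↦ by
    rw [neg_one_zsmul, sub_neg_eq_add, hΦX]
    exact hflip Q
  have hn : ∀ Q : geomTorsion W (p : ℤ), σ₁ • Q - (ψ (p : ZMod d)).val • Q ∈ Φ₀ := fun Q ↦ by
    have h := hψ0 σ₁ Q
    rwa [hχ] at h
  have h := natCast_eq_intCast_of_smul_sub_mem hΦ.1 hs hn
  rwa [ZMod.natCast_zmod_val, Int.cast_neg, Int.cast_one] at h

/-- **`ψ(p) ≠ 1` at an odd prime of non-split multiplicative reduction** — the shape of the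
per-pair hypothesis `hψp` of LEAD g10's `…TwistbackKLFlatPartnerUnits` §1–§3 (no trivial zero of
`L_p(ωψ⁻¹, s)` at `s = 0`), DISCHARGED for a ramified line at a non-split `p`.
[cite: GreenbergVatsal2000, §2 pp. 14–15 and §3 p. 42] -/
theorem psi_natCast_ne_one_of_not_split [W.IsGloballyMinimal] (hp2 : p ≠ 2)
    (hmult : W.HasMultiplicativeReductionAtPrime p)
    (hns : ¬ W.HasSplitMultiplicativeReductionAtPrime p)
    {Φ₀ : AddSubgroup (geomTorsion W (p : ℤ))} (hΦ : IsRationalLine W p Φ₀)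
    (hram : ¬ LineUnramifiedAt W p Φ₀)
    {d : ℕ} [NeZero d] (ψ : DirichletCharacter (ZMod p) d) (hpd : ¬ p ∣ d)
    (hψ0 : ∀ (σ : absoluteGaloisGroup ℚ) (Q : geomTorsion W (p : ℤ)),
      σ • Q - (ψ ((modNCyclotomicCharacter ℚ d σ : (ZMod d)ˣ) : ZMod d)).val • Q ∈ Φ₀) :
    ψ (p : ZMod d) ≠ 1 := by
  rw [psi_natCast_eq_neg_one_of_not_split hp2 hmult hns hΦ hram ψ hpd hψ0]
  -- `−1 ≠ 1` in `𝔽_p`, `p` odd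
  intro h
  have h2 : (2 : ZMod p) = 0 := by linear_combination -h
  have : (p : ℕ) ∣ 2 := by
    rw [show (2 : ZMod p) = ((2 : ℕ) : ZMod p) by norm_cast] at h2
    exact (ZMod.natCast_eq_zero_iff 2 p).mp h2
  exact hp2 ((Nat.prime_dvd_prime_iff_eq hp.out Nat.prime_two).mp this)


/-! ## §4. SPLIT: `ψ(p) = 1` -/

/-- **`ψ(p) = 1` at a prime of SPLIT multiplicative reduction** (any `p`, odd or not). Same data
as `psi_natCast_eq_neg_one_of_not_split` with `p` SPLIT: then `ψ(p) = 1`. Proof: by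
`TateLineDecomposition.fix_or_quot_of_split` (untwisted Tate uniformisation, Silverman *ATAEC*
V.5.3 (b)/V.3.1, DISCHARGED in the tree: `TateCurve.Silverman1994_thmV53_tateUniformisation_holds`)
the decomposition group `D_v` either fixes the `D_v`-stable line `Φ₀` pointwise — impossible, an
inertia element of `𝔓₀ = adicCompletionPrime ℚ v` moves a point of the RAMIFIED line `Φ₀`
(`exists_inertia_smul_ne_of_not_lineUnramifiedAt`, `I_{𝔓₀} ≤ D_v`) — or acts trivially on
`E[p]/Φ₀`; a local Frobenius `τ` then acts as `1` and as `ψ(χ_d(res τ)) = ψ(p)` (§2).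
Greenberg–Vatsal: "if `E` has split multiplicative reduction … `D` is unramified and `Frob_p`
acts trivially" (the trivial-zero case). [cite: GreenbergVatsal2000, §2 pp. 14–15 and §3 p. 42]
[cite: SilvermanATAEC1994, Ch. V Thm. 3.1 (c),(d) p. 423 and §V.5 Thm. 5.3 (a),(b)]
[cite: NeukirchANT1999, Ch. I §10 (10.3) and Ch. II §9 Prop. (9.6)] -/
theorem psi_natCast_eq_one_of_split (hsplit : W.HasSplitMultiplicativeReductionAtPrime p)
    {Φ₀ : AddSubgroup (geomTorsion W (p : ℤ))} (hΦ : IsRationalLine W p Φ₀)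
    (hram : ¬ LineUnramifiedAt W p Φ₀)
    {d : ℕ} [NeZero d] (ψ : DirichletCharacter (ZMod p) d) (hpd : ¬ p ∣ d)
    (hψ0 : ∀ (σ : absoluteGaloisGroup ℚ) (Q : geomTorsion W (p : ℤ)),
      σ • Q - (ψ ((modNCyclotomicCharacter ℚ d σ : (ZMod d)ˣ) : ZMod d)).val • Q ∈ Φ₀) :
    ψ (p : ZMod d) = 1 := by
  have hpp := hp.out
  set v : HeightOneSpectrum (𝓞 ℚ) := (Rat.HeightOneSpectrum.primesEquiv).symm ⟨p, hpp⟩ with hvdef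
  have hv : (Rat.HeightOneSpectrum.primesEquiv v : ℕ) = p := by
    rw [hvdef, Equiv.apply_symm_apply]
  have hpv : ((p : ℕ) : 𝓞 ℚ) ∈ v.asIdeal := natCast_mem_asIdeal_of_primesEquiv_eq hv
  obtain ⟨𝔐, h𝔐⟩ := v.localPrimesAbove_nonempty
  obtain ⟨τ, hτ⟩ := IsDedekindDomain.HeightOneSpectrum.exists_isArithFrobAt_localAbsIntegers v h𝔐
  -- `D_v` fixes `Φ₀` or acts trivially on `E[p]/Φ₀`
  have hE := TateLineDecomposition.fix_or_quot_of_split W p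
    TateCurve.Silverman1994_thmV53_tateUniformisation_holds hsplit hpv hΦ.1
    (fun g _ P hP ↦ hΦ.2 g P hP)
  rcases hE with hfix | hquot
  · -- the ramified line is moved by an inertia element of `𝔓₀`, which lies in `D_v`
    exfalso
    obtain ⟨σ, hσ, P, hP, hne⟩ := exists_inertia_smul_ne_of_not_lineUnramifiedAt hΦ hram v hpv
      (adicCompletionPrime ℚ v) (adicCompletionPrime_mem_primesAbove ℚ v)
    rw [inertia_adicCompletionPrime_eq_map_absInertia] at hσ
    exact hne (hfix σ (inertia_le_decomp v hσ) P hP)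
  · set σ₁ : absoluteGaloisGroup ℚ := absGaloisRestrict ℚ (v.adicCompletion ℚ) τ with hσ₁def
    have hσ₁D : σ₁ ∈ decomp (K := ℚ) v := ⟨τ, rfl⟩
    have hχ : ((modNCyclotomicCharacter ℚ d σ₁ : (ZMod d)ˣ) : ZMod d) = (p : ZMod d) :=
      modNCyclotomicCharacter_absGaloisRestrict_frob hv h𝔐 hτ d hpd
    have hs : ∀ Q : geomTorsion W (p : ℤ), σ₁ • Q - (1 : ℤ) • Q ∈ Φ₀ := fun Q ↦ by
      rw [one_zsmul]
      exact hquot σ₁ hσ₁D Q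
    have hn : ∀ Q : geomTorsion W (p : ℤ), σ₁ • Q - (ψ (p : ZMod d)).val • Q ∈ Φ₀ := fun Q ↦ by
      have h := hψ0 σ₁ Q
      rwa [hχ] at h
    have h := natCast_eq_intCast_of_smul_sub_mem hΦ.1 hs hn
    rwa [ZMod.natCast_zmod_val, Int.cast_one] at h

/-- **`ψ(p) = a_p(E)`, both signs**: at an odd multiplicative prime the quotient character of a
ramified rational line takes at `p` the value `1` if the reduction is split and `−1` otherwise —
i.e. the Hecke eigenvalue `a_p(E) ∈ {±1}` read in `𝔽_p`. [cite: GreenbergVatsal2000, §2 pp. 14–15 and §3 p. 42]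
[cite: SilvermanATAEC1994, Ch. V Lemma 5.2 (c), Thm. 5.3 (a),(b), Cor. 5.4 (held copy PDF pp. 406–410)] -/
theorem psi_natCast_eq_ite [W.IsGloballyMinimal] (hp2 : p ≠ 2)
    (hmult : W.HasMultiplicativeReductionAtPrime p)
    {Φ₀ : AddSubgroup (geomTorsion W (p : ℤ))} (hΦ : IsRationalLine W p Φ₀)
    (hram : ¬ LineUnramifiedAt W p Φ₀)
    {d : ℕ} [NeZero d] (ψ : DirichletCharacter (ZMod p) d) (hpd : ¬ p ∣ d)
    (hψ0 : ∀ (σ : absoluteGaloisGroup ℚ) (Q : geomTorsion W (p : ℤ)),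
      σ • Q - (ψ ((modNCyclotomicCharacter ℚ d σ : (ZMod d)ˣ) : ZMod d)).val • Q ∈ Φ₀) :
    ψ (p : ZMod d) = if W.HasSplitMultiplicativeReductionAtPrime p then 1 else -1 := by
  split_ifs with hsplit
  · exact psi_natCast_eq_one_of_split hsplit hΦ hram ψ hpd hψ0
  · exact psi_natCast_eq_neg_one_of_not_split hp2 hmult hsplit hΦ hram ψ hpd hψ0

/-- **Conversely, `ψ(p) = 1` detects split reduction** at an odd multiplicative prime (for the
data of `psi_natCast_eq_ite`). [cite: GreenbergVatsal2000, §2 pp. 14–15] -/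
theorem hasSplitMultiplicativeReductionAtPrime_iff_psi_natCast_eq_one [W.IsGloballyMinimal]
    (hp2 : p ≠ 2) (hmult : W.HasMultiplicativeReductionAtPrime p)
    {Φ₀ : AddSubgroup (geomTorsion W (p : ℤ))} (hΦ : IsRationalLine W p Φ₀)
    (hram : ¬ LineUnramifiedAt W p Φ₀)
    {d : ℕ} [NeZero d] (ψ : DirichletCharacter (ZMod p) d) (hpd : ¬ p ∣ d)
    (hψ0 : ∀ (σ : absoluteGaloisGroup ℚ) (Q : geomTorsion W (p : ℤ)),
      σ • Q - (ψ ((modNCyclotomicCharacter ℚ d σ : (ZMod d)ˣ) : ZMod d)).val • Q ∈ Φ₀) :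
    W.HasSplitMultiplicativeReductionAtPrime p ↔ ψ (p : ZMod d) = 1 :=
  ⟨fun hsplit ↦ psi_natCast_eq_one_of_split hsplit hΦ hram ψ hpd hψ0, fun h1 ↦ by
    by_contra hns
    exact psi_natCast_ne_one_of_not_split hp2 hmult hns hΦ hram ψ hpd hψ0 h1⟩


/-! ## §5. At the consumers' binders: an isogenous carrier, and the carrier of an admissible twist -/

/-- **`ψ(p) = −1` on a carrier `ℚ`-isogenous to a non-split curve.** For `W/ℚ` globally minimal
with NON-split multiplicative reduction at the odd prime `p` and `V′` globally minimal and
`ℚ`-isogenous to `W` (multiplicative / split type are isogeny invariants: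
`X2.IsogenyQuotientLine`), a ramified rational line `Φ₀ ≤ V′[p]` with quotient character `ψ`
mod `d`, `p ∤ d`, has `ψ(p) = −1`. [cite: GreenbergVatsal2000, §2 pp. 14–15 and p. 28]
[cite: SilvermanAEC2009, §C.16 (definition of L_v(T))] -/
theorem psi_natCast_eq_neg_one_of_isIsogenous_of_not_split [W.IsGloballyMinimal] (hp2 : p ≠ 2)
    (hmult : W.HasMultiplicativeReductionAtPrime p)
    (hns : ¬ W.HasSplitMultiplicativeReductionAtPrime p)
    (V' : WeierstrassCurve ℚ) [V'.IsElliptic] [V'.IsGloballyMinimal] (hiso : IsIsogenous W V')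
    {Φ₀ : AddSubgroup (geomTorsion V' (p : ℤ))} (hΦ : IsRationalLine V' p Φ₀)
    (hram : ¬ LineUnramifiedAt V' p Φ₀)
    {d : ℕ} [NeZero d] (ψ : DirichletCharacter (ZMod p) d) (hpd : ¬ p ∣ d)
    (hψ0 : ∀ (σ : absoluteGaloisGroup ℚ) (Q : geomTorsion V' (p : ℤ)),
      σ • Q - (ψ ((modNCyclotomicCharacter ℚ d σ : (ZMod d)ˣ) : ZMod d)).val • Q ∈ Φ₀) :
    ψ (p : ZMod d) = -1 :=
  psi_natCast_eq_neg_one_of_not_split hp2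
    (IsogenyQuotientLine.hasMultiplicativeReductionAtPrime_of_isIsogenous hiso hmult)
    (fun hs ↦ hns ((IsogenyQuotientLine.hasSplitMultiplicativeReductionAtPrime_iff_of_isIsogenous
      hiso).mpr hs)) hΦ hram ψ hpd hψ0

/-- **At the binders of the KL-flat door** (`…TwistbackKLFlatPartner` §2/§3,
`…TwistbackKLFlatPartnerUnits` §2/§3): `W/ℚ` globally minimal, `p` odd multiplicative and
NON-split for `W`, `K` imaginary quadratic with `p` split in `K` (`SatisfiesHeegnerHypothesis p K`),
`Wd` a globally minimal model of the twist `E^{(d_K)}`, `V′` globally minimal `ℚ`-isogenous to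
`Wd`, `Φ₀ ≤ V′[p]` a ramified rational line with quotient character `ψ` mod `d`, `p ∤ d`. Then
**`ψ(p) ≠ 1`** (indeed `= −1`): the twist keeps the non-split type
(`X2.hasSplitMultiplicativeReductionAtPrime_iff_of_smul_eq_quadraticTwist`), the isogeny too, and §3
applies — so the per-pair hypothesis `hψp : ψ (p : ZMod d) ≠ 1` of those doors is DISCHARGED.
[cite: GreenbergVatsal2000, §2 pp. 14–15 and §3 p. 42] [cite: SilvermanAEC2009, VII.5 Prop. 5.1(b) and X.5 Cor. 5.4] -/
theorem psi_natCast_ne_one_of_twist_carrier (W : WeierstrassCurve ℚ) [W.IsElliptic]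
    [W.IsGloballyMinimal] (p : ℕ) [Fact p.Prime] (hp2 : p ≠ 2)
    (hmult : W.HasMultiplicativeReductionAtPrime p)
    (hns : ¬ W.HasSplitMultiplicativeReductionAtPrime p)
    (K : Type) [Field K] [NumberField K] (hK : IsImaginaryQuadratic K)
    (hHp : SatisfiesHeegnerHypothesis p K)
    (Wd : WeierstrassCurve ℚ) [Wd.IsElliptic] [Wd.IsGloballyMinimal]
    (hWd : ∃ C : VariableChange ℚ, C • Wd = W.quadraticTwist (NumberField.discr K : ℚ))
    (V' : WeierstrassCurve ℚ) [V'.IsElliptic] [V'.IsGloballyMinimal] (hiso : IsIsogenous Wd V')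
    {Φ₀ : AddSubgroup (geomTorsion V' (p : ℤ))} (hΦ : IsRationalLine V' p Φ₀)
    (hram : ¬ LineUnramifiedAt V' p Φ₀)
    {d : ℕ} [NeZero d] (ψ : DirichletCharacter (ZMod p) d) (hpd : ¬ p ∣ d)
    (hψ0 : ∀ (σ : absoluteGaloisGroup ℚ) (Q : geomTorsion V' (p : ℤ)),
      σ • Q - (ψ ((modNCyclotomicCharacter ℚ d σ : (ZMod d)ˣ) : ZMod d)).val • Q ∈ Φ₀) :
    ψ (p : ZMod d) = -1 ∧ ψ (p : ZMod d) ≠ 1 := by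
  obtain ⟨C, hC⟩ := hWd
  have hpdK : ¬ (p : ℤ) ∣ NumberField.discr K := not_dvd_discr_of_split hK Fact.out hp2 hHp
  have hmultd : Wd.HasMultiplicativeReductionAtPrime p :=
    hasMultiplicativeReductionAtPrime_of_smul_eq_quadraticTwist W Wd hC p hp2 hpdK hmult
  have hnsd : ¬ Wd.HasSplitMultiplicativeReductionAtPrime p := fun hs ↦
    hns ((hasSplitMultiplicativeReductionAtPrime_iff_of_smul_eq_quadraticTwist W Wd hK p hp2 hmult hHp
      hC).mp hs)
  have h := psi_natCast_eq_neg_one_of_isIsogenous_of_not_split hp2 hmultd hnsd V' hiso hΦ hram ψ hpd hψ0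
  refine ⟨h, ?_⟩
  rw [h]
  intro h1
  have h2 : (2 : ZMod p) = 0 := by linear_combination -h1
  have : (p : ℕ) ∣ 2 := by
    rw [show (2 : ZMod p) = ((2 : ℕ) : ZMod p) by norm_cast] at h2
    exact (ZMod.natCast_eq_zero_iff 2 p).mp h2
  exact hp2 ((Nat.prime_dvd_prime_iff_eq (Fact.out : p.Prime) Nat.prime_two).mp this)

end Summit.BirchSwinnertonDyer.BirchSwinnertonDyer.Theorems.EisensteinPrimesLinePsiAtMultiplicativePrime

end
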